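import Summits.BirchSwinnertonDyer.BirchSwinnertonDyer.Theorems.AdditiveKolyvaginRoadLevelSystemsCongruence
import HarnessLib

/-!
# Route `AdditiveKolyvaginRoad`, crux `LevelKolyvaginSystemsAdditive` (item stmt-BirchSwinnertonDyer-21396, KS′):
# the transfer socket REPACKAGED over a Galois-equivariant isomorphism of torsion points `E₀[p](K̄) ≃ E[p](K̄)`
# (cell `pub/bsd-wall`, width seat `bsd-wall-akr-p2x-w3` g2; `--supports stmt-BirchSwinnertonDyer-21396`, helper;
# companion of `AdditiveKolyvaginRoadLevelSystemsCongruence` — item (T-A1ℓ) of `Cruxes/…/SOCKETS-TRANSFER.md`)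

WHAT. §1 (θc): for `σ ∈ Aut(K/ℚ)` with a lift `τ` to `K̄` and a `Γ_K`-equivariant `θ : E₀[n](K̄) ≃ E[n](K̄)` that
COMMUTES WITH `τ` on the torsion points (automatic for the reduction of a `ℚ`-rational identification), the induced
`θ_* = h1Equiv θ` commutes with the actions `conjAct σ` on `H¹(K, E₀[n])`, `H¹(K, E[n])` (both composites are the map
of one compatible pair). §2 the SOCKET `nonempty_levelKolyvaginSystemP_of_torsionCongr`: the landed transfer
`nonempty_levelKolyvaginSystemP_of_congr` (p582516) with `θ := h1Equiv θ` and its formal binders DISCHARGED by the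
companion file — (θ0) `h1Equiv_mem_torsionLocalKer_iff`, (θT) `h1Equiv_mem_toricLocalKer_iff`, (θTr)
`h1Equiv_mem_transverseLocalKerP_iff`, (Kol) `isKolyvaginPrime_iff_of_congr`, (Adm) `isAdmissiblePrime_iff_of_congr`,
(θc) §1, and (θK) at every place of good reduction for both curves prime to `p`
(`h1Equiv_mem_selmerLocalKer_iff_of_hasGoodReductionAt`). What is LEFT as hypotheses, besides the frame
(`K` imaginary quadratic, Heegner, `4N ∣ β² − d_K`) and the lender's level system `S₀` (W. Zhang 2014 in print for a
`p`-good ordinary lender): the torsion isomorphism `θ` with its two equivariances; `rad(pN) = rad(pN₀)` and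
`a_q(E) ≡ a_q(E₀) (mod p)` for the primes `q ∤ pN` (the congruence of Hecke eigenvalues off the level); (θK) ONLY at
the finitely many places where one of the curves has bad reduction or which divide `p` — at `v ∣ N N₀` the ♠-type
bookkeeping, at `v ∣ p` THE LOAD-BEARING INPUT of the transfer ideas (parity-forced Lagrangian identity ∕ ε-matching,
cf. `AdditiveKolyvaginRoadLagrangianSwitch`); and (A2) the BOTTOM TRANSFER of Kolyvagin non-vanishing (the ideas' glue).

HONEST FRAMING: theorems only; 0 definitions, 0 named facts, 0 `sorry`; CONDITIONAL on the displayed binders; reach =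
frames with a congruent lender carrying a level system (rational `p`-good shadow: II* census 5 644 ∕ 19 800 classes);
closes nothing. BSD is not proved by any of this.

References: [cite: WZhang2014, Thm. 4.3, Thm. 7.2, §9] [cite: CremonaMazur2000, §3] [cite: GrossLMS1991, §5 (5.1), §7 (7.1)]
[cite: KrizLi2019, Thm. 1.16] [cite: SerreGaloisCohomology1997, I §2.4].
-/

-- single-conjunct summit: `Summit.BirchSwinnertonDyer.BirchSwinnertonDyer.…` repeats the name by design
set_option linter.dupNamespace false

noncomputable section

open scoped Classical

namespace Summit.BirchSwinnertonDyer.BirchSwinnertonDyer.Theorems.AdditiveKoly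

open WeierstrassCurve NumberField IsDedekindDomain Field
  Literature.NumberTheory.EllipticCurves Literature.NumberTheory.EllipticCurves.ModularForms
  Literature.NumberTheory.GaloisRepresentations Module

/-! ## §1 (θc) `θ_*` commutes with the action of `Aut(K/ℚ)` -/

section Conj

variable {K : Type} [Field K] [NumberField K] (W W₀ : WeierstrassCurve ℚ) {n : ℤ}
  (θ : geomTorsion (W₀.baseChange K) n ≃+ geomTorsion (W.baseChange K) n)
  (hθ : ∀ (g : absoluteGaloisGroup K) (P : geomTorsion (W₀.baseChange K) n), θ (g • P) = g • θ P)
include hθ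

/-- **(θc)** If `θ : E₀[n](K̄) ≃ E[n](K̄)` commutes with a lift `τ` of `σ ∈ Aut(K/ℚ)` on the torsion points
(`θ (τ P) = τ (θ P)`), then `θ_* ∘ σ_* = σ_* ∘ θ_*` on `H¹` — both sides are the map of the compatible pair
`(g ↦ τ⁻¹ g τ, τ ∘ θ = θ ∘ τ)`. [cite: GrossLMS1991, §5 (5.1)] [cite: SerreGaloisCohomology1997, I §2.4] -/
theorem h1Equiv_conjAct (σ : K ≃ₐ[ℚ] K) {τ : AlgebraicClosure K ≃+* AlgebraicClosure K} (hτ : IsLiftOfAut σ τ)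
    (hθτ : ∀ P : geomTorsion (W₀.baseChange K) n, θ (hτ.torsionMap W₀ n P) = hτ.torsionMap W n (θ P))
    (y : galH1Torsion (W₀.baseChange K) n) :
    h1Equiv θ hθ (conjAct W₀ σ n y) = conjAct W σ n (h1Equiv θ hθ y) := by
  rw [← hτ.conjH1_eq_conjAct W₀ n, ← hτ.conjH1_eq_conjAct W n]
  change resH1Hom (ContinuousMonoidHom.id _)
      (θ : geomTorsion (W₀.baseChange K) n →+ geomTorsion (W.baseChange K) n) hθ
      (resH1Hom hτ.conjGalCMH (hτ.torsionMap W₀ n) (hτ.torsionMap_smul W₀ n) y) =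
    resH1Hom hτ.conjGalCMH (hτ.torsionMap W n) (hτ.torsionMap_smul W n)
      (resH1Hom (ContinuousMonoidHom.id _)
        (θ : geomTorsion (W₀.baseChange K) n →+ geomTorsion (W.baseChange K) n) hθ y)
  rw [resH1Hom_resH1Hom, resH1Hom_resH1Hom]
  exact congrFun (congrArg DFunLike.coe (resH1Hom_congr (by ext; rfl) (AddMonoidHom.ext fun P ↦ hθτ P) _ _)) y

end Conj

/-! ## §2 The socket over a torsion congruence -/

section Socket

variable (W W₀ : WeierstrassCurve ℚ) (K : Type) [Field K] [NumberField K] (p : ℕ)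
  [W.IsGloballyMinimal] [W₀.IsGloballyMinimal] (c : K ≃ₐ[ℚ] K)
  [Module (ZMod p) (Vp W K p)] [Module (ZMod p) (Vp W₀ K p)]
  [W.IsElliptic] [W₀.IsElliptic] [Fact p.Prime] [NeZero (W.conductorNorm ℤ)] [NeZero (W₀.conductorNorm ℤ)]

/-- **LEVEL KOLYVAGIN SYSTEMS TRANSFER ALONG A TORSION CONGRUENCE `θ : E₀[p](K̄) ≃ E[p](K̄)`.**
Frame: `K` imaginary quadratic, Heegner for `N_E`, `4N ∣ β² − d_K`, complex conjugation `c` with a lift `τ` to `K̄`.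
Lender: `E₀ = W₀` with `Dt₀, β₀` and a level Kolyvagin system `S₀`. Bridge: a `Γ_K`-equivariant additive isomorphism
`θ` of the `p`-torsion points commuting with `τ`; `pN` and `pN₀` with the same prime support and
`a_q(E) ≡ a_q(E₀) (mod p)` for the primes `q ∤ pN`; E's and E₀'s KUMMER conditions identified under `θ_*` at the
finitely many places which divide `p` or are bad for one of the curves (elsewhere this file's companion proves it).
Glue: (A2) the bottom transfer of Kolyvagin non-vanishing. THEN `LevelKolyvaginSystemP W K p Dt β ι c` is inhabited —
`nonempty_levelKolyvaginSystemP_of_congr` with (θ0), (θT), (θTr), (θc), (Kol), (Adm) and the good-place part of (θK)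
discharged. [cite: WZhang2014, Thm. 4.3, Thm. 7.2, §9] [cite: CremonaMazur2000, §3] [cite: KrizLi2019, Thm. 1.16] -/
theorem nonempty_levelKolyvaginSystemP_of_torsionCongr
    (Dt : ModularParametrizationData W (W.conductorNorm ℤ)) (β : ℤ) (ι : K →+* ℂ)
    (Dt₀ : ModularParametrizationData W₀ (W₀.conductorNorm ℤ)) (β₀ : ℤ)
    (hK : IsImaginaryQuadratic K) (hH : SatisfiesHeegnerHypothesis (W.conductorNorm ℤ) K)
    (hβ : (4 * (W.conductorNorm ℤ : ℤ)) ∣ β ^ 2 - NumberField.discr K)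
    (θ : geomTorsion (W₀.baseChange K) ((p ^ 1 : ℕ) : ℤ) ≃+ geomTorsion (W.baseChange K) ((p ^ 1 : ℕ) : ℤ))
    (hθ : ∀ (g : absoluteGaloisGroup K) (P : geomTorsion (W₀.baseChange K) ((p ^ 1 : ℕ) : ℤ)), θ (g • P) = g • θ P)
    {τ : AlgebraicClosure K ≃+* AlgebraicClosure K} (hτ : IsLiftOfAut c τ)
    (hθτ : ∀ P : geomTorsion (W₀.baseChange K) ((p ^ 1 : ℕ) : ℤ),
      θ (hτ.torsionMap W₀ ((p ^ 1 : ℕ) : ℤ) P) = hτ.torsionMap W ((p ^ 1 : ℕ) : ℤ) (θ P))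
    (hrad : ∀ q : ℕ, q.Prime → (q ∣ p * W.conductorNorm ℤ ↔ q ∣ p * W₀.conductorNorm ℤ))
    (ha : ∀ q : ℕ, q.Prime → ¬ q ∣ p * W.conductorNorm ℤ → (p : ℤ) ∣ W.frobeniusTrace q - W₀.frobeniusTrace q)
    (hθK : ∀ (v : HeightOneSpectrum (𝓞 K)),
      ¬ ((W.baseChange K).HasGoodReductionAt v ∧ (W₀.baseChange K).HasGoodReductionAt v ∧ (p : 𝓞 K) ∉ v.asIdeal) →
      ∀ y : Vp W₀ K p, h1Equiv θ hθ y ∈ selmerLocalKer (W.baseChange K) (v.adicCompletion K) ((p ^ 1 : ℕ) : ℤ) ↔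
        y ∈ selmerLocalKer (W₀.baseChange K) (v.adicCompletion K) ((p ^ 1 : ℕ) : ℤ))
    (S₀ : LevelKolyvaginSystemP W₀ K p Dt₀ β₀ ι c)
    (hA2 : (∃ (m₀ : Finset {ℓ // Zhang2014.IsKolyvaginPrime (W₀.conductorNorm ℤ) W₀ K p ℓ})
        (d₀ : KolyvaginHeegnerData Dt₀ β₀ ι (∏ ℓ ∈ m₀, (ℓ : ℕ))), d₀.kolyvaginClass (Fact.out : p.Prime) 1 ≠ 0) →
      ∃ (m : Finset {ℓ // Zhang2014.IsKolyvaginPrime (W.conductorNorm ℤ) W K p ℓ})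
        (d : KolyvaginHeegnerData Dt β ι (∏ ℓ ∈ m, (ℓ : ℕ))), d.kolyvaginClass (Fact.out : p.Prime) 1 ≠ 0) :
    Nonempty (LevelKolyvaginSystemP W K p Dt β ι c) := by
  have hp : p.Prime := Fact.out
  have hn : p ^ 1 ≠ 0 := by rw [pow_one]; exact hp.ne_zero
  refine nonempty_levelKolyvaginSystemP_of_congr W W₀ K p c Dt β ι Dt₀ β₀ hK hH hβ (h1Equiv θ hθ)
    (fun y ↦ h1Equiv_conjAct W W₀ θ hθ c hτ hθτ y) (fun v y ↦ ?_) (fun v y ↦ ?_) (fun v y ↦ ?_)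
    (fun ℓ v y hy ↦ (h1Equiv_mem_transverseLocalKerP_iff W W₀ K p θ hθ ι ℓ v y).mpr hy)
    (isKolyvaginPrime_iff_of_congr W W₀ K p hrad ha)
    (isAdmissiblePrime_iff_of_congr K hrad ha) S₀ hA2
  · -- (θ0) local triviality
    haveI : CharZero (v.adicCompletion K) := charZero_of_injective_algebraMap (algebraMap K _).injective
    exact h1Equiv_mem_torsionLocalKer_iff (W.baseChange K) (W₀.baseChange K) (v.adicCompletion K) hn θ hθ y
  · -- (θK): proved at the good places prime to `p`, a binder elsewhere
    by_cases hv : (W.baseChange K).HasGoodReductionAt v ∧ (W₀.baseChange K).HasGoodReductionAt v ∧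
        (p : 𝓞 K) ∉ v.asIdeal
    · have hvn : ((((p ^ 1 : ℕ) : ℤ)) : 𝓞 K) ∉ v.asIdeal := by
        rw [pow_one, Int.cast_natCast]; exact hv.2.2
      exact h1Equiv_mem_selmerLocalKer_iff_of_hasGoodReductionAt (W.baseChange K) (W₀.baseChange K) θ hθ
        hv.1 hv.2.1 hvn y
    · exact hθK v hv y
  · -- (θT) toric
    haveI : CharZero (v.adicCompletion K) := charZero_of_injective_algebraMap (algebraMap K _).injective
    exact h1Equiv_mem_toricLocalKer_iff (W.baseChange K) (W₀.baseChange K) (v.adicCompletion K) hn θ hθ y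

end Socket

end Summit.BirchSwinnertonDyer.BirchSwinnertonDyer.Theorems.AdditiveKoly

end
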